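import Summits.ValiantsHypothesis.ValiantsHypothesis.Theorems.BarrierLeverPartitionMinorsHitByVPMooreBall

/-!
# Route BarrierLever — item `PartitionMinorsHitByVP` (stmt-ValiantsHypothesis-19717):
# conjecture F_3 («the characteristic-3 Moore table is universal for Hamming-ball rows») — status of record
# and the base case `e ≤ 1` in every prime characteristic

Helper file (`--supports stmt-ValiantsHypothesis-19717`; cell valiant-natproofs, rung V4, 𝒟-side door (c),
prover seat val-np-p6 gen 5). Closes NO item; definition-free. Sequel of `…HitByVPMooreBall` (predicates
`MooreBallNonsingular h e` = F_2(h,e) and `MooreBallNonsingularChar p h e` = F_p(h,e): «for rows = the Hamming ball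
`B([h], e)` in any order and every injective column family, the generalized Vandermonde `[η_{u i}^{Σ_{c∈w j} p^c}]`,
`η_U = Y_none + Σ_{a∈U} Y_(some a)`, is nonzero in `𝔽_p[Y]`»; arrows F_p ⇒ T1 ⇒ «ball rows × ANY columns»).

STATUS OF RECORD (kit j281989, j282567, j282889, j282932, this seat; exact arithmetic in GF(2^64) / GF(3^13) /
GF(5^9) / GF(7^7) / GF(17^7), several independent random points per family — a nonzero value PROVES the symbolic
determinant nonzero, a family counts as failed only if every point gives zero):
* **F_2 is FALSE** from `(h,e) = (5,2)` on: exactly 358 of the 601 080 390 column families (exhaustive) fail — the 99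
  Schur shapes `λ` with `s_λ ≡ 0 (mod 2)` on the sixteen ball nodes (`(2,2), (3,2,1), (4,4,4,4), (5,2,1,1,1), …`), each with
  all its `17 − λ₁` shifts; near-interval exponent families fail in characteristic 2 also at `(6,2), (6,3), (7,2), (7,3),
  (8,3)` (42, 43, 294, 570, 326 of the probed families). F_2 holds exhaustively at `h ≤ 4`, `(5,1)`, `(5,3)`, `(5,4)`, `(6,5)`.
* **F_3 HAS NO KNOWN FAILURE**: it holds for all 601 080 390 families at `(5,2)`, exhaustively at `h ≤ 4`, `(5,1)`, `(5,3)`,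
  `(5,4)`, `(6,5)`, on every probed near-interval family at `h = 6, 7` (where characteristic 2 fails), and on 3.9·10⁶
  random / complement-closed families at `h = 6, 7, 8`; `p = 5, 7` have no failure in 5.6·10⁶ tests, `p = 17 > N` none in
  12·10⁶ tests at `(5,2)`.
* CONJECTURE OF RECORD for the T1 line of item 19717: **F_3 = `∀ h e, MooreBallNonsingularChar 3 h e`** (⇒ T1(h,e) for all
  `h, e` by `ballRowsUniversal_of_moore_char`, ⇒ «ball rows × ANY columns» and its mirror, `r = C(h,≤e)` exponential).

This file proves the base case for every prime: **`mooreBallNonsingularChar_of_le_one`** — F_p(h,e) for `e ≤ 1`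
(substitution `Y_none ↦ Z_{i_∅}`, `Y_(some a) ↦ Z_{i_a} − Z_{i_∅}` onto distinct indeterminates; `binp_injective`: base-`p`
weights of distinct sets are distinct; `det_X_pow_ne_zero` of `…HitByVPMooreBall`).

WHAT THIS IS NOT: F_3 and T1 are OPEN for `e ≥ 2`; nothing on CPM (20172/20195), crux 14610 or VP vs VNP.
-/

set_option linter.dupNamespace false

namespace Summit.ValiantsHypothesis.ValiantsHypothesis.Theorems.BarrierLever.FrobeniusDoor

open Finset MvPolynomial Matrix

noncomputable section

variable {h : ℕ}

/-- The base-`p` weight of `W` (`p ≥ 2`) is the value of its `0/1` digit vector under `finFunctionFinEquiv`. -/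
theorem binp_eq_finFunctionFinEquiv {p : ℕ} (hp : 2 ≤ p) (W : Finset (Fin h)) :
    ∑ c ∈ W, p ^ (c : ℕ) =
      ((finFunctionFinEquiv fun c : Fin h => if c ∈ W then (⟨1, hp⟩ : Fin p) else ⟨0, by omega⟩ :
        Fin (p ^ h)) : ℕ) := by
  rw [finFunctionFinEquiv_apply]
  have : ∀ c : Fin h, (((if c ∈ W then (⟨1, hp⟩ : Fin p) else ⟨0, by omega⟩ : Fin p) : ℕ) * p ^ (c : ℕ)) =
      if c ∈ W then p ^ (c : ℕ) else 0 := by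
    intro c
    split_ifs <;> simp
  simp_rw [this]
  rw [← Finset.sum_filter, Finset.filter_mem_eq_inter, Finset.univ_inter]

/-- Base-`p` weights (`p ≥ 2`) of distinct subsets are distinct. -/
theorem binp_injective {p : ℕ} (hp : 2 ≤ p) :
    Function.Injective fun W : Finset (Fin h) => ∑ c ∈ W, p ^ (c : ℕ) := by
  intro W W' hWW'
  have h1 : (finFunctionFinEquiv fun c : Fin h => if c ∈ W then (⟨1, hp⟩ : Fin p) else ⟨0, by omega⟩ :
      Fin (p ^ h)) =
      finFunctionFinEquiv fun c : Fin h => if c ∈ W' then (⟨1, hp⟩ : Fin p) else ⟨0, by omega⟩ := by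
    apply Fin.ext
    rw [← binp_eq_finFunctionFinEquiv hp, ← binp_eq_finFunctionFinEquiv hp]
    exact hWW'
  have h2 := finFunctionFinEquiv.injective h1
  ext c
  have h3 := congrFun h2 c
  by_cases hc : c ∈ W <;> by_cases hc' : c ∈ W' <;> simp_all

/-- **F_p(h, 0)** for every prime `p`. -/
theorem mooreBallNonsingularChar_zero (p : ℕ) [Fact p.Prime] : MooreBallNonsingularChar p h 0 := by
  classical
  intro r u w hu hw hsmall hall
  have hue : ∀ i, u i = ∅ := fun i => Finset.card_eq_zero.mp (Nat.le_zero.mp (hsmall i))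
  have hr : r ≤ 1 := by
    by_contra hr1
    have h01 : (⟨0, by omega⟩ : Fin r) = ⟨1, by omega⟩ := hu ((hue _).trans (hue _).symm)
    exact absurd (congrArg Fin.val h01) (by simp)
  have hne : ∀ U : Finset (Fin h),
      (X none + ∑ b ∈ U, X (some b) : MvPolynomial (Option (Fin h)) (ZMod p)) ≠ 0 := by
    intro U h0
    have := congrArg (eval fun o : Option (Fin h) => if o = none then (1 : ZMod p) else 0) h0
    rw [map_add, map_sum, eval_X, if_pos rfl, map_zero] at this
    simp [eval_X] at this
  interval_cases r
  · simp [Matrix.det_isEmpty]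
  · rw [Matrix.det_fin_one, Matrix.of_apply]
    exact pow_ne_zero _ (hne _)

/-- **F_p(h, 1)** for every prime `p`: the substitution `Y_none ↦ Z_{i_∅}`, `Y_(some a) ↦ Z_{i_a} − Z_{i_∅}` maps the
nodes of the rows `∅`, `{a}` onto distinct indeterminates, and `det_X_pow_ne_zero` applies. -/
theorem mooreBallNonsingularChar_one (p : ℕ) [hp : Fact p.Prime] : MooreBallNonsingularChar p h 1 := by
  classical
  intro r u w hu hw hsmall hall
  obtain ⟨i₀, hi₀⟩ := hall ∅ (by simp)
  have hsing : ∀ a : Fin h, ∃ i, u i = {a} := fun a => hall {a} (by simp)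
  choose ι hι using hsing
  let g : Option (Fin h) → MvPolynomial (Fin r) (ZMod p) :=
    fun o => Option.elim o (X i₀) fun a => X (ι a) - X i₀
  have hnode : ∀ i, aeval g (X none + ∑ a ∈ u i, X (some a) :
      MvPolynomial (Option (Fin h)) (ZMod p)) = X i := by
    intro i
    rcases (u i).eq_empty_or_nonempty with h0 | hne
    · have hi : i = i₀ := hu (h0.trans hi₀.symm)
      rw [h0, Finset.sum_empty, add_zero, aeval_X, hi]
      rfl
    · obtain ⟨a, h1⟩ := Finset.card_eq_one.mp (le_antisymm (hsmall i) (Finset.card_pos.mpr hne))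
      have hi : i = ι a := hu (h1.trans (hι a).symm)
      rw [h1, Finset.sum_singleton, map_add, aeval_X, aeval_X, hi]
      show (X i₀ : MvPolynomial (Fin r) (ZMod p)) + (X (ι a) - X i₀) = X (ι a)
      ring
  have hmat : (aeval g).toRingHom.mapMatrix (Matrix.of fun i j : Fin r =>
      ((X none + ∑ a ∈ u i, X (some a) : MvPolynomial (Option (Fin h)) (ZMod p))) ^
        (∑ c ∈ w j, p ^ (c : ℕ))) =
      Matrix.of fun i j : Fin r => (X i : MvPolynomial (Fin r) (ZMod p)) ^ (∑ c ∈ w j, p ^ (c : ℕ)) := by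
    refine Matrix.ext fun i j => ?_
    rw [RingHom.mapMatrix_apply, Matrix.map_apply, Matrix.of_apply, Matrix.of_apply, AlgHom.toRingHom_eq_coe,
      RingHom.coe_coe, map_pow, hnode]
  intro h0
  apply det_X_pow_ne_zero (R := ZMod p) (fun j : Fin r => ∑ c ∈ w j, p ^ (c : ℕ))
    ((binp_injective hp.out.two_le).comp hw)
  rw [← hmat, ← RingHom.map_det, h0, map_zero]

/-- **F_p(h, e) for `e ≤ 1` and every prime `p`.** -/
theorem mooreBallNonsingularChar_of_le_one (p : ℕ) [Fact p.Prime] {e : ℕ} (he : e ≤ 1) :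
    MooreBallNonsingularChar p h e := by
  interval_cases e
  · exact mooreBallNonsingularChar_zero p
  · exact mooreBallNonsingularChar_one p

/-- In particular F_3(h, e) — the conjecture of record — holds for `e ≤ 1`. -/
theorem mooreBallNonsingularChar_three_of_le_one {e : ℕ} (he : e ≤ 1) : MooreBallNonsingularChar 3 h e :=
  haveI : Fact (Nat.Prime 3) := ⟨Nat.prime_three⟩
  mooreBallNonsingularChar_of_le_one 3 he

end

end Summit.ValiantsHypothesis.ValiantsHypothesis.Theorems.BarrierLever.FrobeniusDoor
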